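import Mathlib
import HarnessLib
import Literature.MathematicalPhysics.QuantumLattice.FinDimSpectrumProofs
import Literature.MathematicalPhysics.QuantumLattice.XYOrderGDProofs

/-!
# Crux `WcbcsBcsConstruction`, line `lro-seed-kink-bridge`: sector selection for a state average

Support file (`--supports stmt-HubbardSuperconductivity-2010`, registered sub-goal
`stub_lroSeedSelection`) for the converse certificate `stub_lroSeedOfOrderFloor` of the line
`lro-seed-kink-bridge` (order floor ⇒ number-definite LRO seeds). Pure finite-dimensional matrix
analysis on `m → ℂ` with an `ℕ`-grading `deg : m → ℕ` (think: particle number of a Fock basis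
state), sector projections `Q_n = diagonal 1_{deg = n}` and a tracial ground state
`ω = K.groundStateFunctional` (`K` Hermitian):

* `Q_n` is a Hermitian idempotent, `Σ_n Q_n = 1`, and a `deg`-block-diagonal `M` is `Σ_n Q_n M Q_n`;
* the top Rayleigh bound `Q_n M Q_n ≤ λ_n` (`λ_n = -E₀(-Q_n M Q_n)`) gives, after conjugation by `Q_n`
  and positivity of `ω`, `Re ω(Q_n M Q_n) ≤ λ_n Re ω(Q_n)`, hence `Re ω(M) ≤ max_n λ_n`;
* `stub_lroSeedSelection`: if `Re ω(M) > 0` there is a UNIT vector supported in ONE sector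
  `{deg = n₀}` (a top eigenvector of the block `Q_{n₀} M Q_{n₀}`) with `Re ω(M) ≤ Re⟨v, Mv⟩`.

No definitions; everything is proved.
-/

set_option linter.dupNamespace false

namespace Summit.HubbardSuperconductivity.HubbardSuperconductivity.Theorems

open Literature.MathematicalPhysics.QuantumLattice Literature.Probability.LatticeModels Matrix Filter
open scoped Matrix.Norms.L2Operator ComplexOrder Topology

namespace WcbcsLroSeed

variable {m : Type*} [Fintype m] [DecidableEq m]

/-! ### Sector projections of an `ℕ`-grading -/

/-- The sector projection acts entrywise as the indicator of the sector. [folklore] -/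
theorem sectorProj_mulVec_apply (deg : m → ℕ) (n : ℕ) (w : m → ℂ) (s : m) :
    (diagonal (fun t => if deg t = n then (1 : ℂ) else 0) *ᵥ w) s = if deg s = n then w s else 0 := by
  rw [mulVec_diagonal]
  split_ifs <;> simp

/-- The sector projection is idempotent. [folklore] -/
theorem sectorProj_mul_self (deg : m → ℕ) (n : ℕ) :
    diagonal (fun t => if deg t = n then (1 : ℂ) else 0) *
        diagonal (fun t => if deg t = n then (1 : ℂ) else 0) =
      diagonal (fun t => if deg t = n then (1 : ℂ) else 0) := by
  rw [diagonal_mul_diagonal]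
  congr 1
  funext t
  split_ifs <;> simp

omit [Fintype m] in
/-- The sector projection is Hermitian. [folklore] -/
theorem sectorProj_conjTranspose (deg : m → ℕ) (n : ℕ) :
    (diagonal (fun t => if deg t = n then (1 : ℂ) else 0))ᴴ =
      diagonal (fun t => if deg t = n then (1 : ℂ) else 0) := by
  rw [diagonal_conjTranspose]
  congr 1
  funext t
  rw [Pi.star_apply]
  split_ifs <;> simp

/-- The sector projection is positive semidefinite. [folklore] -/
theorem sectorProj_posSemidef (deg : m → ℕ) (n : ℕ) :
    (diagonal (fun t => if deg t = n then (1 : ℂ) else 0)).PosSemidef := by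
  have h := posSemidef_conjTranspose_mul_self (diagonal (fun t => if deg t = n then (1 : ℂ) else 0))
  rwa [sectorProj_conjTranspose, sectorProj_mul_self] at h

/-- The sector projections over the (finite) range of the grading sum to the identity. [folklore] -/
theorem sum_sectorProj (deg : m → ℕ) :
    ∑ n ∈ Finset.univ.image deg, diagonal (fun t => if deg t = n then (1 : ℂ) else 0) =
      (1 : Matrix m m ℂ) := by
  ext i j
  rw [Matrix.sum_apply]
  by_cases hij : i = j
  · subst hij
    simp only [diagonal_apply_eq, one_apply_eq]
    rw [Finset.sum_ite_eq]
    simp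
  · simp [diagonal_apply_ne _ hij, one_apply_ne hij]

/-- Entries of the sector block `Q_n M Q_n`. [folklore] -/
theorem sectorBlock_apply (deg : m → ℕ) (n : ℕ) (M : Matrix m m ℂ) (s t : m) :
    (diagonal (fun t => if deg t = n then (1 : ℂ) else 0) * M *
        diagonal (fun t => if deg t = n then (1 : ℂ) else 0)) s t =
      if deg s = n ∧ deg t = n then M s t else 0 := by
  rw [mul_diagonal, diagonal_mul]
  by_cases hs : deg s = n <;> by_cases ht : deg t = n <;> simp [hs, ht]

/-- A block-diagonal matrix is the sum of its sector blocks. [folklore] -/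
theorem sum_sectorBlock (deg : m → ℕ) {M : Matrix m m ℂ}
    (hM : ∀ s t, deg s ≠ deg t → M s t = 0) :
    ∑ n ∈ Finset.univ.image deg,
        diagonal (fun t => if deg t = n then (1 : ℂ) else 0) * M *
          diagonal (fun t => if deg t = n then (1 : ℂ) else 0) = M := by
  ext s t
  rw [Matrix.sum_apply]
  simp only [sectorBlock_apply]
  by_cases hst : deg s = deg t
  · have h1 : ∀ n, (if deg s = n ∧ deg t = n then M s t else 0) = if deg s = n then M s t else 0 := by
      intro n
      rw [← hst]
      simp only [and_self]
    simp_rw [h1]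
    rw [Finset.sum_ite_eq]
    simp
  · rw [hM s t hst]
    simp

/-- The sector projection fixes vectors supported in its sector. [folklore] -/
theorem sectorProj_mulVec_of_support (deg : m → ℕ) (n : ℕ) {v : m → ℂ}
    (hv : ∀ s, deg s ≠ n → v s = 0) :
    diagonal (fun t => if deg t = n then (1 : ℂ) else 0) *ᵥ v = v := by
  funext s
  rw [sectorProj_mulVec_apply]
  split_ifs with h
  · rfl
  · exact (hv s h).symm

omit [DecidableEq m] in
/-- Moving a Hermitian matrix across the inner product. [folklore] -/
theorem star_dotProduct_mulVec_of_conjTranspose_eq {Q : Matrix m m ℂ} (hQ : Qᴴ = Q) (u w : m → ℂ) :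
    star u ⬝ᵥ (Q *ᵥ w) = star (Q *ᵥ u) ⬝ᵥ w := by
  rw [star_mulVec, hQ, ← dotProduct_mulVec]

/-! ### The top Rayleigh bound and the state average of a block -/

/-- `λ • 1 - A ≥ 0` for the top eigenvalue `λ = -E₀(-A)` of a Hermitian `A`. [folklore] -/
theorem posSemidef_top_sub {A : Matrix m m ℂ} (hA : A.IsHermitian) :
    (((-(-A).groundEnergy : ℝ) : ℂ) • (1 : Matrix m m ℂ) - A).PosSemidef := by
  have h := posSemidef_sub_groundEnergy hA.neg
  rw [Algebra.algebraMap_eq_smul_one, RCLike.real_smul_eq_coe_smul (K := ℂ)] at h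
  have e : ((-(-A).groundEnergy : ℝ) : ℂ) • (1 : Matrix m m ℂ) - A =
      -A - (((-A).groundEnergy : ℝ) : ℂ) • (1 : Matrix m m ℂ) := by
    set E : ℝ := (-A).groundEnergy
    rw [Complex.ofReal_neg, neg_smul]
    abel
  rw [e]
  exact h

/-- Top Rayleigh bound: `Re⟨w, A w⟩ ≤ λ Re⟨w, w⟩`, `λ = -E₀(-A)`. [folklore] -/
theorem re_rayleigh_le_top {A : Matrix m m ℂ} (hA : A.IsHermitian) (w : m → ℂ) :
    (star w ⬝ᵥ (A *ᵥ w)).re ≤ -(-A).groundEnergy * (star w ⬝ᵥ w).re := by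
  have h := (posSemidef_top_sub hA).re_dotProduct_nonneg w
  rw [sub_mulVec, dotProduct_sub, smul_mulVec, one_mulVec, dotProduct_smul, smul_eq_mul] at h
  rw [RCLike.re_to_complex, Complex.sub_re, Complex.re_ofReal_mul] at h
  linarith

/-- Averaging a block in a state: `Re ω(Q M Q) ≤ λ(Q M Q) · Re ω(Q)` for a Hermitian idempotent
`Q` and the tracial ground state `ω` of any matrix `K` (`λ Q - QMQ = Q (λ - QMQ) Q ≥ 0`). [folklore] -/
theorem re_groundStateFunctional_block_le (K : Matrix m m ℂ) {Q M : Matrix m m ℂ} (hQ : Qᴴ = Q)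
    (hQQ : Q * Q = Q) (hB : (Q * M * Q).IsHermitian) :
    (K.groundStateFunctional (Q * M * Q)).re ≤
      -(-(Q * M * Q)).groundEnergy * (K.groundStateFunctional Q).re := by
  set lam : ℝ := -(-(Q * M * Q)).groundEnergy with hlam
  have h2 := (posSemidef_top_sub hB).mul_mul_conjTranspose_same Q
  have h3 : Q * (((lam : ℝ) : ℂ) • (1 : Matrix m m ℂ) - Q * M * Q) * Qᴴ = (lam : ℂ) • Q - Q * M * Q := by
    rw [hQ, mul_sub, sub_mul, Matrix.mul_smul, mul_one, Matrix.smul_mul, hQQ]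
    congr 1
    simp only [Matrix.mul_assoc, hQQ]
    rw [← Matrix.mul_assoc Q Q, hQQ]
  rw [h3] at h2
  have h4 := groundStateFunctional_nonneg_of_posSemidef K h2
  rw [map_sub, map_smul, smul_eq_mul] at h4
  obtain ⟨hre, -⟩ := Complex.nonneg_iff.mp h4
  rw [Complex.sub_re, Complex.re_ofReal_mul] at hre
  linarith

/-- A unit top eigenvector: `A v = λ v`, `λ = -E₀(-A)`, `‖v‖ = 1`. [folklore] -/
theorem exists_unit_top_eigenvector [Nonempty m] {A : Matrix m m ℂ} (hA : A.IsHermitian) :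
    ∃ v : m → ℂ, star v ⬝ᵥ v = 1 ∧ A *ᵥ v = (((-(-A).groundEnergy : ℝ)) : ℂ) • v := by
  obtain ⟨v, hv1, hvE⟩ := exists_groundState_unit hA.neg
  have hmem := (rayleigh_eq_groundEnergy_iff_holds hA.neg v hv1).1 hvE
  rw [mem_groundSpace_iff, neg_mulVec] at hmem
  refine ⟨v, hv1, ?_⟩
  rw [Complex.ofReal_neg, neg_smul, ← hmem, neg_neg]

end WcbcsLroSeed

/-! ### The selection lemma (registered sub-goal) -/

open WcbcsLroSeed in
/-- **Sector selection.** For an `ℕ`-grading `deg` of a finite index type, a Hermitian `K` with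
tracial ground state `ω = K.groundStateFunctional`, and a Hermitian `deg`-block-diagonal `M` with
`Re ω(M) > 0`, some UNIT vector `v` supported in a single sector `{deg = n₀}` has
`Re ω(M) ≤ Re⟨v, M v⟩`: `Re ω(M) = Σ_n Re ω(Q_n M Q_n) ≤ Σ_n λ_n Re ω(Q_n) ≤ max_n λ_n`, attained by a
top eigenvector of the best block, which lies in that sector because its eigenvalue is non-zero.
[folklore] -/
theorem stub_lroSeedSelection :
    ∀ {m : Type} [Fintype m] [DecidableEq m] [Nonempty m] (deg : m → ℕ) {K M : Matrix m m ℂ},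
      K.IsHermitian → M.IsHermitian → (∀ s t, deg s ≠ deg t → M s t = 0) →
      0 < (K.groundStateFunctional M).re →
      ∃ (n₀ : ℕ) (v : m → ℂ), star v ⬝ᵥ v = 1 ∧ (∀ s, deg s ≠ n₀ → v s = 0) ∧
        (K.groundStateFunctional M).re ≤ (star v ⬝ᵥ (M *ᵥ v)).re := by
  intro m _ _ _ deg K M hK hM hblock hpos
  -- the sector projections `Q n` and the top block eigenvalues `lam n`, as opaque functions
  obtain ⟨Q, hQ⟩ : ∃ Q : ℕ → Matrix m m ℂ,
      ∀ n, Q n = diagonal (fun t => if deg t = n then (1 : ℂ) else 0) := ⟨_, fun _ => rfl⟩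
  obtain ⟨lam, hlam⟩ : ∃ lam : ℕ → ℝ, ∀ n, lam n = -(-(Q n * M * Q n)).groundEnergy :=
    ⟨_, fun _ => rfl⟩
  have hSne : (Finset.univ.image deg).Nonempty := Finset.image_nonempty.2 Finset.univ_nonempty
  have hQh : ∀ n, (Q n)ᴴ = Q n := fun n => by
    rw [hQ]
    exact sectorProj_conjTranspose deg n
  have hQQ : ∀ n, Q n * Q n = Q n := fun n => by
    rw [hQ]
    exact sectorProj_mul_self deg n
  have hBh : ∀ n, (Q n * M * Q n).IsHermitian := fun n => by
    have : Q n * M * Q n = Q n * M * (Q n)ᴴ := by rw [hQh]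
    rw [this]
    exact Matrix.isHermitian_mul_mul_conjTranspose _ hM
  -- the best block
  obtain ⟨n₀, hn₀S, hmax⟩ := Finset.exists_max_image (Finset.univ.image deg) lam hSne
  -- `Re ω(M) ≤ lam n₀`
  have hωQ_nonneg : ∀ n, 0 ≤ (K.groundStateFunctional (Q n)).re := fun n => by
    have hpsd : (Q n).PosSemidef := by
      rw [hQ]
      exact sectorProj_posSemidef deg n
    obtain ⟨hre, -⟩ := Complex.nonneg_iff.mp (groundStateFunctional_nonneg_of_posSemidef K hpsd)
    exact hre
  have hsumQ1 : ∑ n ∈ Finset.univ.image deg, Q n = 1 := by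
    simp only [hQ]
    exact sum_sectorProj deg
  have hsumB : ∑ n ∈ Finset.univ.image deg, Q n * M * Q n = M := by
    simp only [hQ]
    exact sum_sectorBlock deg hblock
  have hsumQ : ∑ n ∈ Finset.univ.image deg, (K.groundStateFunctional (Q n)).re = 1 := by
    rw [← Complex.re_sum, ← map_sum, hsumQ1, groundStateFunctional_one hK, Complex.one_re]
  have hsumM : (K.groundStateFunctional M).re =
      ∑ n ∈ Finset.univ.image deg, (K.groundStateFunctional (Q n * M * Q n)).re := by
    rw [← Complex.re_sum, ← map_sum, hsumB]
  have hle : (K.groundStateFunctional M).re ≤ lam n₀ := by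
    calc (K.groundStateFunctional M).re
        = ∑ n ∈ Finset.univ.image deg, (K.groundStateFunctional (Q n * M * Q n)).re := hsumM
      _ ≤ ∑ n ∈ Finset.univ.image deg, lam n * (K.groundStateFunctional (Q n)).re :=
          Finset.sum_le_sum fun n _ => by
            rw [hlam]
            exact re_groundStateFunctional_block_le K (hQh n) (hQQ n) (hBh n)
      _ ≤ ∑ n ∈ Finset.univ.image deg, lam n₀ * (K.groundStateFunctional (Q n)).re :=
          Finset.sum_le_sum fun n hn => mul_le_mul_of_nonneg_right (hmax n hn) (hωQ_nonneg n)
      _ = lam n₀ := by rw [← Finset.mul_sum, hsumQ, mul_one]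
  have hlam_pos : 0 < lam n₀ := lt_of_lt_of_le hpos hle
  -- a unit top eigenvector of the best block
  obtain ⟨v, hv1, hv⟩ := exists_unit_top_eigenvector (hBh n₀)
  rw [← hlam] at hv
  have hsupp : ∀ s, deg s ≠ n₀ → v s = 0 := by
    intro s hs
    have h1 := congrFun hv s
    rw [Matrix.mul_assoc, ← mulVec_mulVec, hQ, sectorProj_mulVec_apply, if_neg hs, Pi.smul_apply,
      smul_eq_mul] at h1
    have hne : ((lam n₀ : ℝ) : ℂ) ≠ 0 := Complex.ofReal_ne_zero.2 hlam_pos.ne'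
    exact (mul_eq_zero.1 h1.symm).resolve_left hne
  refine ⟨n₀, v, hv1, hsupp, ?_⟩
  have hQv : Q n₀ *ᵥ v = v := by
    rw [hQ]
    exact sectorProj_mulVec_of_support deg n₀ hsupp
  have hMv : star v ⬝ᵥ (M *ᵥ v) = star v ⬝ᵥ ((Q n₀ * M * Q n₀) *ᵥ v) := by
    symm
    rw [← mulVec_mulVec, ← mulVec_mulVec, hQv, star_dotProduct_mulVec_of_conjTranspose_eq (hQh n₀),
      hQv]
  rw [hMv, hv, dotProduct_smul, hv1, smul_eq_mul, mul_one, Complex.ofReal_re]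
  exact hle

end Summit.HubbardSuperconductivity.HubbardSuperconductivity.Theorems
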